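import Summits.ABC.IUTFork.Repair.CandInternal2RealLabels
import Summits.ABC.IUTFork.Cor312PilotIdelesPrInclusion
import Summits.ABC.IUTFork.Cor312ProvKIdeles
import HarnessLib

/-!
# IUT REPAIR branch → R-H (D-0079 «local-height condition I06⋆»): the I06⋆ CELL AT GENUINE PILOT DATA, decided stratum by stratum
# (`Repair/EvalI06StarGenuine`; abc-iut-rp-plan ruling R41 (2)(a), R-H SEATS.tsv row «rp-x3 g4 · R41a»)

PROOF-ONLY file (0 definitions, 0 `Prop` facts) of the abc-iut cell (IUT REPAIR branch B / RESCUE sub-cell R-H; seat abc-iut-rp-x3 gen 4).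
TAKES NO SIDE on [IUTchIII] Cor. 3.12 or on any author (Mochizuki / Scholze–Stix / Joshi / Dupuy–Hilado); the «cell» below is a statement
about OUR typed objects (abc-iut-c312-7's rescaled completions `kOf X p x = K_x`, the REAL log-shell `ℐ_x = (p*)⁻¹·log_p(𝒪^×_{K_x})` of
[AbsTopIII] Def. 5.4 (iii) = `logShell (PadicLogOnUnits.ofUnitLog p K_x)`, Dupuy–Hilado's realising pilot ideles); typed ≠ proved;
decided-AS-TYPED ≠ decided-in-print; refuted-as-typed ≠ refuted-in-print.

THE CELL (R-H START-HERE v1.1 §1, `plan/rescue/R-H/`; H-num-1's I06STAR-COLUMNS). Row RP-I06⋆ = `CandInternal11Gap.HQShellOrbitStar` read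
at the data level on the real shell: at a bad place `x | p` of the pilot datum `X` and a label `j = i+1 ∈ 𝔽_l^⋇`, the q-pilot's Kummer datum
lies in the Θ-pilot's datum times the log-shell. For REALISING ideles ([IUTchI] Ex. 3.2 (iv): `q̲_x` a `2l`-th root of the q-parameter;
Dupuy–Hilado (3.4): `log ‖t_{q,x}‖ = −P_q(x)·log N(x)/n_x`, `log ‖t_{Θ,j,x}‖ = −P_{Θ,j}(x)·log N(x)/n_x`, `P_{Θ,j} = j²·P_q`) the cell is the
membership **`t_{q,x} ∈ t_{Θ,j,x} · ℐ_x`** in `K_x`, with `‖t_{q,x}‖ = p^{−h}`, `h = ord_x(q)/(2l·e_x)` (`§2`) and `‖t_{Θ,j,x}‖ = ‖t_{q,x}‖^{j²}`.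

WHAT IS PROVED (kernel; every decider is abc-iut-rp-d2's REAL-LABELS window `CandInternal2RealLabels` / `CandInternal2Real`, BY NAME, in the
TWO-ELEMENT form the genuine bed needs — the Θ-idele is not literally `t_q^{j²}`, only its norm is).
§1 (any complete `K/ℚ_p`): `mem_smul_of_norm_le` / `norm_le_of_mem_smul`; the window in heights for two elements `u`, `t` with `‖u‖ = p^{−h_u}`,
`‖t‖ = p^{−h_t}`: `mem_smul_logShell_of_heights` (`h_t − h_u ≤ c − a_e ⟹ u ∈ t·ℐ_K`), `heights_le_of_mem_smul_logShell` (`u ∈ t·ℐ_K ⟹ h_t − h_u ≤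
b_e + c`), `not_mem_smul_logShell_of_lt`, and the TAME closed form `mem_smul_logShell_iff_of_tame` (`p > 2`, `e ≤ p − 2`: `u ∈ t·ℐ_K ⟺
h_t − h_u ≤ 1 − 1/e`).
§2 (any number field `F`, any pilot datum `X : PilotData F`, REALISING ideles `t`, `tq`): `norm_qIdele_eq_rpow_of_realises` (`‖t_{q,x}‖ =
p^{−ord_x(q)/(2l·e_x)}`), `norm_thetaIdele_eq_rpow_of_realises` (`‖t_{Θ,i+1,x}‖ = p^{−(i+1)²·ord_x(q)/(2l·e_x)}`).
§3 THE DATUM-CLASS DECIDERS at a bad place `x | p` of `X` (the table's `i06star_cell`, BY NAME): **`qIdele_mem_thetaIdele_smul_logShell_of_le`**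
(POS ⟸ `((i+1)² − 1)·ord_x(q) ≤ 2l·e_x·(c − a_{e_x})`), **`qIdele_not_mem_thetaIdele_smul_logShell_of_lt`** (NEG ⟸ `2l·e_x·(b_{e_x} + c) <
((i+1)² − 1)·ord_x(q)`), **`qIdele_mem_thetaIdele_smul_logShell_iff_of_tame`** (TAME `p > 2`, `e_x ≤ p − 2`: POS ⟺ `((i+1)² − 1)·ord_x(q) ≤
2l·(e_x − 1)` — the table's `slack_j ≥ 0` in `x`-units, INTEGERS).
§4 AT PRINT'S OWN `K`-LEVEL DATUM `pilotDataOfK D K` of EVERY initial Θ-datum `D` ([IUTchI] Def. 3.1), for every realising idele pair and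
hence for the CHOSEN ones (`exists_realising_*_pilotDataOfK`): the three deciders with `ord_x(q) = e(x|v)·ord_v(q_v)` (`ordq_pilotDataOfK`),
statements mentioning `pilotDataOfK` (`tame_cell_iff_pilotDataOfK`, `pos_cell_pilotDataOfK`, `neg_cell_pilotDataOfK`).
READING FOR THE TABLE (neutral): with `m_q(x) := ord_x(q)/(2l) ∈ ℤ` (`twoMulLDvdOrdq_pilotDataOfK`), `d⁻ := c·e − ⌈e/(p−2)⌉`, `d⁺ := e·b_e + c·e`:
POS ⟸ `((i+1)²−1)·m_q ≤ d⁻`, NEG ⟸ `d⁺ < ((i+1)²−1)·m_q`, tame POS ⟺ `((i+1)²−1)·m_q ≤ e − 1`; the unramified-odd TYPE of the F-place does not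
occur as a K_x-cell (at `pilotDataOfK`, `e_x ≥ l`); the deep stratum (`e ≥ p`) stays SHAPE-OPEN between the two windows (no claim here).
No judgement on print; nothing asserts abc or Cor. 3.12 proved or refuted. [cite: MochizukiAbsTopIII2015, Def 5.4 (iii) p. 126]
[cite: Mochizuki2012, IUTchI Ex. 3.2 (iv) p. 71; IUTchIV Prop. 1.2 (i)] [cite: DupuyHilado2025, §3.3, §3.4] [claim: Mochizuki2012, status: disputed]
-/

noncomputable section

open Set Metric Function NumberField IsDedekindDomain
open scoped Pointwise

namespace Summit.ABC.IUTFork.Repair.EvalI06StarGenuine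

open Literature.AnabelianGeometry.AbsoluteAnabelian Literature.IUT.LogThetaLattice Literature.IUT.LogVolume
  Summit.ABC.IUTFork.Repair.CandInternal2Real Summit.ABC.IUTFork.Repair.CandInternal2RealLabels

/-! ## §1. The two-element window at the real log-shell of any complete `K/ℚ_p` -/

section NormedField

variable {K : Type*} [NormedField K]

/-- If `I` contains the ball of radius `r`, `t ≠ 0` and `‖u‖ ≤ ‖t‖·r`, then `u ∈ t·I` (witness `t⁻¹·u`). [folklore] -/
theorem mem_smul_of_norm_le {u t : K} {I : Set K} {r : ℝ} (hI : closedBall (0 : K) r ⊆ I) (ht : t ≠ 0) (h : ‖u‖ ≤ ‖t‖ * r) :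
    u ∈ t • I := by
  refine Set.mem_smul_set.2 ⟨t⁻¹ * u, hI ?_, ?_⟩
  · rw [mem_closedBall, dist_zero_right, norm_mul, norm_inv]
    have hpos : 0 < ‖t‖ := norm_pos_iff.2 ht
    rw [inv_mul_le_iff₀ hpos]
    exact h
  · rw [smul_eq_mul, ← mul_assoc, mul_inv_cancel₀ ht, one_mul]

/-- If `I` lies in the ball of radius `R` and `u ∈ t·I`, then `‖u‖ ≤ ‖t‖·R`. [folklore] -/
theorem norm_le_of_mem_smul {u t : K} {I : Set K} {R : ℝ} (hI : I ⊆ closedBall (0 : K) R) (h : u ∈ t • I) : ‖u‖ ≤ ‖t‖ * R := by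
  obtain ⟨ι, hι, rfl⟩ := Set.mem_smul_set.1 h
  have hιR : ‖ι‖ ≤ R := by simpa [mem_closedBall, dist_zero_right] using hI hι
  rw [smul_eq_mul, norm_mul]
  exact mul_le_mul_of_nonneg_left hιR (norm_nonneg t)

end NormedField

section Real

variable (p : ℕ) [Fact p.Prime]
variable (K : Type*) [NontriviallyNormedField K] [NormedAlgebra ℚ_[p] K] [IsUltrametricDist K] [ProperSpace K]

/-- **WINDOW, lower edge (two elements)**: with `‖u‖ = p^{−h_u}`, `‖t‖ = p^{−h_t}`, `t ≠ 0`: `h_t − h_u ≤ c − a_e ⟹ u ∈ t·ℐ_K`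
([IUTchIV] Prop. 1.2 (i) lower inclusion, via abc-iut-rp-d2's `closedBall_radiusA_subset_logShell`). [cite: MochizukiAbsTopIII2015, Def 5.4 (iii) p. 126] -/
theorem mem_smul_logShell_of_heights {u t : K} (ht : t ≠ 0) {hu hθ : ℝ} (hun : ‖u‖ = (p : ℝ) ^ (-hu)) (htn : ‖t‖ = (p : ℝ) ^ (-hθ))
    (hle : hθ - hu ≤ ((if p = 2 then 2 else 1 : ℕ) : ℝ) - logRadiusA p (absRamificationIdx p K)) :
    u ∈ t • logShell (PadicLogOnUnits.ofUnitLog p K) := by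
  apply mem_smul_of_norm_le (closedBall_radiusA_subset_logShell p K) ht
  have hp1 : (1 : ℝ) < p := by exact_mod_cast (Fact.out : p.Prime).one_lt
  have hp0 : (0 : ℝ) < p := by linarith
  rw [norm_pstar_inv_eq_rpow p K, hun, htn, ← Real.rpow_add hp0, ← Real.rpow_add hp0, Real.rpow_le_rpow_left_iff hp1]
  linarith

/-- **WINDOW, upper edge (two elements)**: `u ∈ t·ℐ_K ⟹ h_t − h_u ≤ b_e + c` ([IUTchIV] Prop. 1.2 (i) upper inclusion, via abc-iut-rp-d2's
`logShell_ofUnitLog_subset_closedBall`). [cite: MochizukiAbsTopIII2015, Def 5.4 (iii) p. 126] -/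
theorem heights_le_of_mem_smul_logShell {u t : K} (ht : t ≠ 0) {hu hθ : ℝ} (hun : ‖u‖ = (p : ℝ) ^ (-hu))
    (htn : ‖t‖ = (p : ℝ) ^ (-hθ)) (hmem : u ∈ t • logShell (PadicLogOnUnits.ofUnitLog p K)) :
    hθ - hu ≤ logRadiusB p (absRamificationIdx p K) + ((if p = 2 then 2 else 1 : ℕ) : ℝ) := by
  have hle := norm_le_of_mem_smul (logShell_ofUnitLog_subset_closedBall p K) hmem
  have hp1 : (1 : ℝ) < p := by exact_mod_cast (Fact.out : p.Prime).one_lt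
  have hp0 : (0 : ℝ) < p := by linarith
  have htpos : (0 : ℝ) < ‖t‖ := norm_pos_iff.2 ht
  rw [norm_pstar_inv_eq_rpow p K, hun, htn, ← Real.rpow_add hp0, ← Real.rpow_add hp0, Real.rpow_le_rpow_left_iff hp1] at hle
  linarith

/-- … hence **NEG**: `b_e + c < h_t − h_u ⟹ u ∉ t·ℐ_K`. [cite: MochizukiAbsTopIII2015, Def 5.4 (iii) p. 126] -/
theorem not_mem_smul_logShell_of_lt {u t : K} (ht : t ≠ 0) {hu hθ : ℝ} (hun : ‖u‖ = (p : ℝ) ^ (-hu)) (htn : ‖t‖ = (p : ℝ) ^ (-hθ))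
    (hlt : logRadiusB p (absRamificationIdx p K) + ((if p = 2 then 2 else 1 : ℕ) : ℝ) < hθ - hu) :
    u ∉ t • logShell (PadicLogOnUnits.ofUnitLog p K) := fun hmem =>
  absurd (heights_le_of_mem_smul_logShell p K ht hun htn hmem) (not_le.2 hlt)

/-- **TAME CLOSED FORM (two elements)**: for `p > 2`, `e ≤ p − 2` ([IUTchIV] Prop. 1.2 (i) equality clause `a_e = 1/e = −b_e`, `c = 1`):
`u ∈ t·ℐ_K ⟺ h_t − h_u ≤ 1 − 1/e`. [cite: MochizukiAbsTopIII2015, Def 5.4 (iii) p. 126] -/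
theorem mem_smul_logShell_iff_of_tame (hp : 2 < p) (he : absRamificationIdx p K ≤ p - 2) {u t : K} (ht : t ≠ 0) {hu hθ : ℝ}
    (hun : ‖u‖ = (p : ℝ) ^ (-hu)) (htn : ‖t‖ = (p : ℝ) ^ (-hθ)) :
    u ∈ t • logShell (PadicLogOnUnits.ofUnitLog p K) ↔ hθ - hu ≤ 1 - 1 / (absRamificationIdx p K : ℝ) := by
  have he1 := absRamificationIdx_pos p K
  have ha := logRadiusA_eq hp he1 he
  have hb := logRadiusB_eq hp he1 he
  have hc : ((if p = 2 then 2 else 1 : ℕ) : ℝ) = 1 := by rw [if_neg (by omega)]; simp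
  constructor
  · intro hmem
    have h := heights_le_of_mem_smul_logShell p K ht hun htn hmem
    rw [hb, hc] at h
    linarith
  · intro hle
    refine mem_smul_logShell_of_heights p K ht hun htn ?_
    rw [ha, hc]
    linarith

end Real

/-! ## §2. Realising ideles of a pilot datum: the two norms as powers of `p` -/

section Realising

open Thm311 Thm311.Real Cor312 Cor312Vol Cor312Prov

variable {F : Type} [Field F] [NumberField F] (X : PilotData F)
  (t : ∀ (pp : Nat.Primes) (_ : Fin X.lstar) (x : (thetaIndex X).Fibre (.inr pp)),
    haveI : Fact (pp : ℕ).Prime := ⟨pp.2⟩; kOf X pp.1 x)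
  (ht0 : ∀ pp i x, t pp i x ≠ 0)
  (ht : ∀ (pp : Nat.Primes) (i : Fin X.lstar) (x : (thetaIndex X).Fibre (.inr pp)),
    haveI : Fact (pp : ℕ).Prime := ⟨pp.2⟩
    Real.log ‖t pp i x‖ = -(X.thetaPilot i (placeOf X pp.1 x)) * logNorm F (placeOf X pp.1 x) /
      localDegree F (placeOf X pp.1 x))
  (tq : ∀ (pp : Nat.Primes) (x : (thetaIndex X).Fibre (.inr pp)), haveI : Fact (pp : ℕ).Prime := ⟨pp.2⟩; kOf X pp.1 x)
  (htq0 : ∀ pp x, tq pp x ≠ 0)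
  (htq : ∀ (pp : Nat.Primes) (x : (thetaIndex X).Fibre (.inr pp)),
    haveI : Fact (pp : ℕ).Prime := ⟨pp.2⟩
    Real.log ‖tq pp x‖ = -(X.qPilot (placeOf X pp.1 x)) * logNorm F (placeOf X pp.1 x) /
      localDegree F (placeOf X pp.1 x))

include htq0 htq in
/-- **`‖t_{q,x}‖ = p^{−ord_x(q)/(2l·e_x)}`** at a bad place `x | p` for a REALISING q-idele (`P_q(x) = ord_x(q)/2l`, `log N(x)/n_x = log p/e_x`).
[cite: DupuyHilado2025, §3.3, §3.4] -/
theorem norm_qIdele_eq_rpow_of_realises (pp : Nat.Primes) [Fact (pp : ℕ).Prime] (x : (thetaIndex X).Fibre (.inr pp)) (hx : placeOf X pp.1 x ∈ X.S) :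
    ‖tq pp x‖ = ((pp : ℕ) : ℝ) ^
      (-((X.ordq (placeOf X pp.1 x) : ℝ) / (2 * X.l * ((placeOf X pp.1 x).asIdeal.ramificationIdx ℤ : ℝ)))) := by
  have hp0 : (0 : ℝ) < (pp : ℕ) := by exact_mod_cast pp.2.pos
  have hpos : 0 < ‖tq pp x‖ := norm_pos_iff.2 (htq0 pp x)
  have h := htq pp x
  rw [mul_div_assoc, logNorm_div_localDegree X pp.1 x, PilotData.qPilot_apply_of_mem X hx] at h
  rw [← Real.exp_log hpos, h, Real.rpow_def_of_pos hp0]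
  congr 1
  have he : ((placeOf X pp.1 x).asIdeal.ramificationIdx ℤ : ℝ) ≠ 0 := by exact_mod_cast (Ideal.ramificationIdx_pos _ _).ne'
  have hl : (X.l : ℝ) ≠ 0 := by
    have h5 := X.five_le_l
    exact_mod_cast (by omega : X.l ≠ 0)
  field_simp

include ht htq htq0 in
/-- **`‖t_{Θ,i+1,x}‖ = p^{−(i+1)²·ord_x(q)/(2l·e_x)}`** at a bad place for REALISING ideles (HONEST `j²`-scaling, `P_{Θ,j} = j²·P_q`, via
abc-iut-c312-7's `log_norm_thetaIdele_eq_of_realises`). [cite: DupuyHilado2025, §3.3, §3.4] -/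
theorem norm_thetaIdele_eq_rpow_of_realises (pp : Nat.Primes) [Fact (pp : ℕ).Prime] (i : Fin X.lstar) (x : (thetaIndex X).Fibre (.inr pp))
    (hx : placeOf X pp.1 x ∈ X.S) :
    ‖t pp i x‖ = ((pp : ℕ) : ℝ) ^
      (-((((i : ℕ) : ℝ) + 1) ^ 2 * ((X.ordq (placeOf X pp.1 x) : ℝ) / (2 * X.l * ((placeOf X pp.1 x).asIdeal.ramificationIdx ℤ : ℝ))))) := by
  have hp0 : (0 : ℝ) < (pp : ℕ) := by exact_mod_cast pp.2.pos
  have hq := norm_qIdele_eq_rpow_of_realises X tq htq0 htq pp x hx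
  have hqpos : 0 < ‖tq pp x‖ := norm_pos_iff.2 (htq0 pp x)
  have hlogq : Real.log ‖tq pp x‖ =
      -((X.ordq (placeOf X pp.1 x) : ℝ) / (2 * X.l * ((placeOf X pp.1 x).asIdeal.ramificationIdx ℤ : ℝ))) * Real.log (pp : ℕ) := by
    rw [hq, Real.log_rpow hp0]
  have hθ := log_norm_thetaIdele_eq_of_realises X t ht tq htq pp i x
  have htpos : 0 < ‖t pp i x‖ := by
    rw [← Real.exp_log hqpos] at hqpos
    by_contra h0
    have h0' : ‖t pp i x‖ = 0 := le_antisymm (not_lt.1 h0) (norm_nonneg _)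
    -- `log 0 = 0` would force `(i+1)²·log ‖t_q‖ = 0`, contradicting `‖t_q‖ < 1`? — not needed: use the realising equation instead
    rw [h0', Real.log_zero] at hθ
    have hneg : Real.log ‖tq pp x‖ < 0 := by
      rw [hlogq]
      have hord : (0 : ℝ) < (X.ordq (placeOf X pp.1 x) : ℝ) := by exact_mod_cast X.ordq_pos hx
      have hl : (0 : ℝ) < X.l := by have h5 := X.five_le_l; exact_mod_cast (by omega : 0 < X.l)
      have he : (0 : ℝ) < ((placeOf X pp.1 x).asIdeal.ramificationIdx ℤ : ℝ) := by exact_mod_cast Ideal.ramificationIdx_pos _ _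
      have hlp : 0 < Real.log (pp : ℕ) := Real.log_pos (by exact_mod_cast pp.2.one_lt)
      have : 0 < (X.ordq (placeOf X pp.1 x) : ℝ) / (2 * X.l * ((placeOf X pp.1 x).asIdeal.ramificationIdx ℤ : ℝ)) := by positivity
      nlinarith
    have hsq : (0 : ℝ) < (((i : ℕ) : ℝ) + 1) ^ 2 := by positivity
    nlinarith
  rw [← Real.exp_log htpos, hθ, hlogq, Real.rpow_def_of_pos hp0]
  congr 1
  ring

/-! ## §3. The datum-class deciders of the I06⋆ cell at a bad place of a pilot datum -/

include ht0 ht htq0 htq in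
/-- **POS CELL** (any stratum): at a bad place `x | p` and label `j = i+1`, `((i+1)² − 1)·ord_x(q) ≤ 2l·e_x·(c − a_{e_x})` ⟹
`t_{q,x} ∈ t_{Θ,i+1,x} · ℐ_x` — the table's «arith-pos ⇒ DECIDED-POS» for the datum class «realising ideles of a pilot datum».
[cite: MochizukiAbsTopIII2015, Def 5.4 (iii) p. 126] [cite: DupuyHilado2025, §3.4] -/
theorem qIdele_mem_thetaIdele_smul_logShell_of_le (pp : Nat.Primes) [Fact (pp : ℕ).Prime] (i : Fin X.lstar) (x : (thetaIndex X).Fibre (.inr pp))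
    (hx : placeOf X pp.1 x ∈ X.S)
    (hle :
      ((((i : ℕ) : ℝ) + 1) ^ 2 - 1) * (X.ordq (placeOf X pp.1 x) : ℝ) ≤
        2 * X.l * ((placeOf X pp.1 x).asIdeal.ramificationIdx ℤ : ℝ) *
          (((if (pp : ℕ) = 2 then 2 else 1 : ℕ) : ℝ) - logRadiusA pp (absRamificationIdx pp (kOf X pp.1 x)))) :
    tq pp x ∈ t pp i x • logShell (PadicLogOnUnits.ofUnitLog (pp : ℕ) (kOf X pp.1 x)) := by
  refine mem_smul_logShell_of_heights pp (kOf X pp.1 x) (ht0 pp i x) (norm_qIdele_eq_rpow_of_realises X tq htq0 htq pp x hx)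
    (norm_thetaIdele_eq_rpow_of_realises X t ht tq htq0 htq pp i x hx) ?_
  have he : (0 : ℝ) < ((placeOf X pp.1 x).asIdeal.ramificationIdx ℤ : ℝ) := by exact_mod_cast Ideal.ramificationIdx_pos _ _
  have hl : (0 : ℝ) < X.l := by have h5 := X.five_le_l; exact_mod_cast (by omega : 0 < X.l)
  have hd : (0 : ℝ) < 2 * X.l * ((placeOf X pp.1 x).asIdeal.ramificationIdx ℤ : ℝ) := by positivity
  rw [← sub_one_mul, mul_div_assoc', div_le_iff₀ hd]
  linarith

include ht0 ht htq0 htq in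
/-- **NEG CELL** (any stratum): `2l·e_x·(b_{e_x} + c) < ((i+1)² − 1)·ord_x(q)` ⟹ `t_{q,x} ∉ t_{Θ,i+1,x} · ℐ_x` — the table's «arith-neg ⇒
DECIDED-NEG». [cite: MochizukiAbsTopIII2015, Def 5.4 (iii) p. 126] [cite: DupuyHilado2025, §3.4] -/
theorem qIdele_not_mem_thetaIdele_smul_logShell_of_lt (pp : Nat.Primes) [Fact (pp : ℕ).Prime] (i : Fin X.lstar) (x : (thetaIndex X).Fibre (.inr pp))
    (hx : placeOf X pp.1 x ∈ X.S)
    (hlt :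
      2 * X.l * ((placeOf X pp.1 x).asIdeal.ramificationIdx ℤ : ℝ) *
          (logRadiusB pp (absRamificationIdx pp (kOf X pp.1 x)) + ((if (pp : ℕ) = 2 then 2 else 1 : ℕ) : ℝ)) <
        ((((i : ℕ) : ℝ) + 1) ^ 2 - 1) * (X.ordq (placeOf X pp.1 x) : ℝ)) :
    tq pp x ∉ t pp i x • logShell (PadicLogOnUnits.ofUnitLog (pp : ℕ) (kOf X pp.1 x)) := by
  refine not_mem_smul_logShell_of_lt pp (kOf X pp.1 x) (ht0 pp i x) (norm_qIdele_eq_rpow_of_realises X tq htq0 htq pp x hx)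
    (norm_thetaIdele_eq_rpow_of_realises X t ht tq htq0 htq pp i x hx) ?_
  have he : (0 : ℝ) < ((placeOf X pp.1 x).asIdeal.ramificationIdx ℤ : ℝ) := by exact_mod_cast Ideal.ramificationIdx_pos _ _
  have hl : (0 : ℝ) < X.l := by have h5 := X.five_le_l; exact_mod_cast (by omega : 0 < X.l)
  have hd : (0 : ℝ) < 2 * X.l * ((placeOf X pp.1 x).asIdeal.ramificationIdx ℤ : ℝ) := by positivity
  rw [← sub_one_mul, mul_div_assoc', lt_div_iff₀ hd]
  linarith

include ht0 ht htq0 htq in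
/-- **TAME CELL, CLOSED FORM** (`p > 2`, `e_x ≤ p − 2`): `t_{q,x} ∈ t_{Θ,i+1,x} · ℐ_x ⟺ ((i+1)² − 1)·ord_x(q) ≤ 2l·(e_x − 1)` — the table's
`slack_j = (e_x − 1) − (j² − 1)·m_q(x) ≥ 0` in `x`-units (`ord_x(q) = 2l·m_q(x)`), now DECIDING both ways.
[cite: MochizukiAbsTopIII2015, Def 5.4 (iii) p. 126] [cite: DupuyHilado2025, §3.4] -/
theorem qIdele_mem_thetaIdele_smul_logShell_iff_of_tame (pp : Nat.Primes) [Fact (pp : ℕ).Prime] (hp : 2 < (pp : ℕ)) (i : Fin X.lstar)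
    (x : (thetaIndex X).Fibre (.inr pp)) (hx : placeOf X pp.1 x ∈ X.S)
    (he : absRamificationIdx pp (kOf X pp.1 x) ≤ pp - 2) :
    tq pp x ∈ t pp i x • logShell (PadicLogOnUnits.ofUnitLog (pp : ℕ) (kOf X pp.1 x)) ↔
      ((((i : ℕ) : ℤ) + 1) ^ 2 - 1) * X.ordq (placeOf X pp.1 x) ≤ 2 * X.l * (((placeOf X pp.1 x).asIdeal.ramificationIdx ℤ : ℤ) - 1) := by
  rw [mem_smul_logShell_iff_of_tame pp (kOf X pp.1 x) hp he (ht0 pp i x) (norm_qIdele_eq_rpow_of_realises X tq htq0 htq pp x hx)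
    (norm_thetaIdele_eq_rpow_of_realises X t ht tq htq0 htq pp i x hx),
    absRamificationIdx_rescaledCompletion F pp.1 (placeOf X pp.1 x) (natCast_mem_placeOf X pp.1 x)]
  have he0 : (0 : ℝ) < ((placeOf X pp.1 x).asIdeal.ramificationIdx ℤ : ℝ) := by exact_mod_cast Ideal.ramificationIdx_pos _ _
  have hl : (0 : ℝ) < X.l := by have h5 := X.five_le_l; exact_mod_cast (by omega : 0 < X.l)
  have hd : (0 : ℝ) < 2 * X.l * ((placeOf X pp.1 x).asIdeal.ramificationIdx ℤ : ℝ) := by positivity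
  have key : (((i : ℕ) : ℝ) + 1) ^ 2 * ((X.ordq (placeOf X pp.1 x) : ℝ) / (2 * X.l * ((placeOf X pp.1 x).asIdeal.ramificationIdx ℤ : ℝ))) -
      (X.ordq (placeOf X pp.1 x) : ℝ) / (2 * X.l * ((placeOf X pp.1 x).asIdeal.ramificationIdx ℤ : ℝ)) ≤
        1 - 1 / ((placeOf X pp.1 x).asIdeal.ramificationIdx ℤ : ℝ) ↔
      ((((i : ℕ) : ℝ) + 1) ^ 2 - 1) * (X.ordq (placeOf X pp.1 x) : ℝ) ≤
        2 * X.l * (((placeOf X pp.1 x).asIdeal.ramificationIdx ℤ : ℝ) - 1) := by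
    rw [← sub_one_mul, mul_div_assoc', div_le_iff₀ hd]
    have e1 : (1 - 1 / ((placeOf X pp.1 x).asIdeal.ramificationIdx ℤ : ℝ)) * (2 * X.l * ((placeOf X pp.1 x).asIdeal.ramificationIdx ℤ : ℝ)) =
        2 * X.l * (((placeOf X pp.1 x).asIdeal.ramificationIdx ℤ : ℝ) - 1) := by
      field_simp
    rw [e1]
  rw [key]
  constructor
  · intro h; exact_mod_cast h
  · intro h; exact_mod_cast h

end Realising

/-! ## §4. At print's own `K`-level pilot datum `pilotDataOfK D K` of every initial Θ-datum -/

section Genuine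

open Thm311 Thm311.Real Cor312 Cor312Vol Cor312Prov Literature.IUT.HodgeTheaters

variable {F K Fbar : Type} [Field F] [NumberField F] [Field K] [NumberField K] [Algebra F K] [Field Fbar]
  [Algebra F Fbar] [Algebra K Fbar] {E : WeierstrassCurve F} [E.IsElliptic] {l : ℕ} {Pb : BadPlacePredicates K}
  (D : InitialThetaData F K Fbar E l Pb)
  (t : ∀ (pp : Nat.Primes) (_ : Fin (pilotDataOfK D K).lstar) (x : (thetaIndex (pilotDataOfK D K)).Fibre (.inr pp)),
    haveI : Fact (pp : ℕ).Prime := ⟨pp.2⟩; kOf (pilotDataOfK D K) pp.1 x)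
  (ht0 : ∀ pp i x, t pp i x ≠ 0)
  (ht : ∀ (pp : Nat.Primes) (i : Fin (pilotDataOfK D K).lstar) (x : (thetaIndex (pilotDataOfK D K)).Fibre (.inr pp)),
    haveI : Fact (pp : ℕ).Prime := ⟨pp.2⟩
    Real.log ‖t pp i x‖ = -((pilotDataOfK D K).thetaPilot i (placeOf (pilotDataOfK D K) pp.1 x)) *
      logNorm K (placeOf (pilotDataOfK D K) pp.1 x) / localDegree K (placeOf (pilotDataOfK D K) pp.1 x))
  (tq : ∀ (pp : Nat.Primes) (x : (thetaIndex (pilotDataOfK D K)).Fibre (.inr pp)),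
    haveI : Fact (pp : ℕ).Prime := ⟨pp.2⟩; kOf (pilotDataOfK D K) pp.1 x)
  (htq0 : ∀ pp x, tq pp x ≠ 0)
  (htq : ∀ (pp : Nat.Primes) (x : (thetaIndex (pilotDataOfK D K)).Fibre (.inr pp)),
    haveI : Fact (pp : ℕ).Prime := ⟨pp.2⟩
    Real.log ‖tq pp x‖ = -((pilotDataOfK D K).qPilot (placeOf (pilotDataOfK D K) pp.1 x)) *
      logNorm K (placeOf (pilotDataOfK D K) pp.1 x) / localDegree K (placeOf (pilotDataOfK D K) pp.1 x))

include ht0 ht htq0 htq in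
/-- **TAME CELL AT `pilotDataOfK D K`, CLOSED FORM** (realising ideles; `p > 2`, `e_x ≤ p − 2`): at a bad place `x | p` of `K` (i.e. over
`𝕍(F)^bad`) and the label `j = i+1`, the I06⋆ cell `t_{q,x} ∈ t_{Θ,j,x}·ℐ_x` holds IFF `((i+1)² − 1)·e(x|v)·ord_v(q_v) ≤ 2l·(e_x − 1)` — with
`ord_x(q) = e(x|v)·ord_v(q_v)` from `ordq_pilotDataOfK` ([IUTchI] Def. 3.1 (c)). [cite: Mochizuki2012, IUTchI Def. 3.1 (c) p. 61, Ex. 3.2 (iv) p. 71]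
[cite: MochizukiAbsTopIII2015, Def 5.4 (iii) p. 126] -/
theorem tame_cell_iff_pilotDataOfK (pp : Nat.Primes) [Fact (pp : ℕ).Prime] (hp : 2 < (pp : ℕ)) (i : Fin (pilotDataOfK D K).lstar)
    (x : (thetaIndex (pilotDataOfK D K)).Fibre (.inr pp)) (hx : placeOf (pilotDataOfK D K) pp.1 x ∈ (pilotDataOfK D K).S)
    (he : absRamificationIdx pp (kOf (pilotDataOfK D K) pp.1 x) ≤ pp - 2) :
    tq pp x ∈ t pp i x • logShell (PadicLogOnUnits.ofUnitLog (pp : ℕ) (kOf (pilotDataOfK D K) pp.1 x)) ↔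
      ((((i : ℕ) : ℤ) + 1) ^ 2 - 1) *
          (((finBelow F K (placeOf (pilotDataOfK D K) pp.1 x)).asIdeal.ramificationIdx'
              (placeOf (pilotDataOfK D K) pp.1 x).asIdeal : ℤ) *
            (qParamOrd E (finBelow F K (placeOf (pilotDataOfK D K) pp.1 x)) : ℤ)) ≤
        2 * l * (((placeOf (pilotDataOfK D K) pp.1 x).asIdeal.ramificationIdx ℤ : ℤ) - 1) := by
  rw [qIdele_mem_thetaIdele_smul_logShell_iff_of_tame (pilotDataOfK D K) t ht0 ht tq htq0 htq pp hp i x hx he,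
    ordq_pilotDataOfK D K hx, pilotDataOfK_l]

include ht0 ht htq0 htq in
/-- **POS CELL AT `pilotDataOfK D K`** (any stratum): `((i+1)² − 1)·ord_x(q) ≤ 2l·e_x·(c − a_{e_x})` ⟹ the cell holds.
[cite: MochizukiAbsTopIII2015, Def 5.4 (iii) p. 126] [cite: Mochizuki2012, IUTchI Ex. 3.2 (iv) p. 71] -/
theorem pos_cell_pilotDataOfK (pp : Nat.Primes) [Fact (pp : ℕ).Prime] (i : Fin (pilotDataOfK D K).lstar) (x : (thetaIndex (pilotDataOfK D K)).Fibre (.inr pp))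
    (hx : placeOf (pilotDataOfK D K) pp.1 x ∈ (pilotDataOfK D K).S)
    (hle :
      ((((i : ℕ) : ℝ) + 1) ^ 2 - 1) * ((pilotDataOfK D K).ordq (placeOf (pilotDataOfK D K) pp.1 x) : ℝ) ≤
        2 * (pilotDataOfK D K).l * ((placeOf (pilotDataOfK D K) pp.1 x).asIdeal.ramificationIdx ℤ : ℝ) *
          (((if (pp : ℕ) = 2 then 2 else 1 : ℕ) : ℝ) - logRadiusA pp (absRamificationIdx pp (kOf (pilotDataOfK D K) pp.1 x)))) :
    tq pp x ∈ t pp i x • logShell (PadicLogOnUnits.ofUnitLog (pp : ℕ) (kOf (pilotDataOfK D K) pp.1 x)) :=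
  qIdele_mem_thetaIdele_smul_logShell_of_le (pilotDataOfK D K) t ht0 ht tq htq0 htq pp i x hx hle

include ht0 ht htq0 htq in
/-- **NEG CELL AT `pilotDataOfK D K`** (any stratum): `2l·e_x·(b_{e_x} + c) < ((i+1)² − 1)·ord_x(q)` ⟹ the cell fails — in particular the
TOP-LABEL negatives of the [IUTchIV] regime (large `(l⋆² − 1)·ord_v(q_v)` against the shell index).
[cite: MochizukiAbsTopIII2015, Def 5.4 (iii) p. 126] [cite: Mochizuki2012, IUTchI Ex. 3.2 (iv) p. 71] -/
theorem neg_cell_pilotDataOfK (pp : Nat.Primes) [Fact (pp : ℕ).Prime] (i : Fin (pilotDataOfK D K).lstar) (x : (thetaIndex (pilotDataOfK D K)).Fibre (.inr pp))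
    (hx : placeOf (pilotDataOfK D K) pp.1 x ∈ (pilotDataOfK D K).S)
    (hlt :
      2 * (pilotDataOfK D K).l * ((placeOf (pilotDataOfK D K) pp.1 x).asIdeal.ramificationIdx ℤ : ℝ) *
          (logRadiusB pp (absRamificationIdx pp (kOf (pilotDataOfK D K) pp.1 x)) + ((if (pp : ℕ) = 2 then 2 else 1 : ℕ) : ℝ)) <
        ((((i : ℕ) : ℝ) + 1) ^ 2 - 1) * ((pilotDataOfK D K).ordq (placeOf (pilotDataOfK D K) pp.1 x) : ℝ)) :
    tq pp x ∉ t pp i x • logShell (PadicLogOnUnits.ofUnitLog (pp : ℕ) (kOf (pilotDataOfK D K) pp.1 x)) :=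
  qIdele_not_mem_thetaIdele_smul_logShell_of_lt (pilotDataOfK D K) t ht0 ht tq htq0 htq pp i x hx hlt

omit t ht0 ht tq htq0 htq in
/-- **TAME CELL AT `pilotDataOfK D K`, HYPOTHESIS-FREE** (abc-iut-rp-cx's `EvalRealGenuine` pattern): the closed form for the realising ideles
CHOSEN by `exists_realising_thetaIdeles_pilotDataOfK` / `exists_realising_qIdeles_pilotDataOfK` ([IUTchI] Ex. 3.2 (iv)) — no idele hypothesis
left. [cite: Mochizuki2012, IUTchI Def. 3.1 (c) p. 61, Ex. 3.2 (iv) p. 71] [cite: MochizukiAbsTopIII2015, Def 5.4 (iii) p. 126] -/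
theorem tame_cell_iff_pilotDataOfK_chosen (pp : Nat.Primes) [Fact (pp : ℕ).Prime] (hp : 2 < (pp : ℕ)) (i : Fin (pilotDataOfK D K).lstar)
    (x : (thetaIndex (pilotDataOfK D K)).Fibre (.inr pp)) (hx : placeOf (pilotDataOfK D K) pp.1 x ∈ (pilotDataOfK D K).S)
    (he : absRamificationIdx pp (kOf (pilotDataOfK D K) pp.1 x) ≤ pp - 2) :
    (exists_realising_qIdeles_pilotDataOfK D).choose pp x ∈
        (exists_realising_thetaIdeles_pilotDataOfK D).choose pp i x •
          logShell (PadicLogOnUnits.ofUnitLog (pp : ℕ) (kOf (pilotDataOfK D K) pp.1 x)) ↔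
      ((((i : ℕ) : ℤ) + 1) ^ 2 - 1) *
          (((finBelow F K (placeOf (pilotDataOfK D K) pp.1 x)).asIdeal.ramificationIdx'
              (placeOf (pilotDataOfK D K) pp.1 x).asIdeal : ℤ) *
            (qParamOrd E (finBelow F K (placeOf (pilotDataOfK D K) pp.1 x)) : ℤ)) ≤
        2 * l * (((placeOf (pilotDataOfK D K) pp.1 x).asIdeal.ramificationIdx ℤ : ℤ) - 1) :=
  tame_cell_iff_pilotDataOfK D (exists_realising_thetaIdeles_pilotDataOfK D).choose
    (exists_realising_thetaIdeles_pilotDataOfK D).choose_spec.1 (exists_realising_thetaIdeles_pilotDataOfK D).choose_spec.2.2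
    (exists_realising_qIdeles_pilotDataOfK D).choose (exists_realising_qIdeles_pilotDataOfK D).choose_spec.1
    (exists_realising_qIdeles_pilotDataOfK D).choose_spec.2.2 pp hp i x hx he

end Genuine

end Summit.ABC.IUTFork.Repair.EvalI06StarGenuine

end
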